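import Summits.NavierStokesRegularity.FunctionalMining.StrainSqTransport
import Literature.Analysis.FluidPDE.TorusPressurePoisson
import Literature.Analysis.FunctionSpaces.TorusLowOrderLeibniz
import HarnessLib

/-!
# FunctionalMining — the viscous term of the weighted strain balance by parts

Search for candidate a priori estimates; no regularity claim. Cell `pub-nsfunc`, prove seat
(gen 9). The viscous term of `d/dt ∫ Ψ(|S|²)` (`GradientTensor.hasDerivWithinAt_integral_comp_strainSqAt`)
is `2ν ∫ Ψ'(|S|²) ∑ᵢⱼ Sᵢⱼ (∂ᵢΔv)ⱼ`. For smooth `v` on `T^d` and `g` smooth on an open set containing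
the values of `|S|²`, this file integrates it by parts:

`∫ g'(|S|²) ∑ᵢⱼ Sᵢⱼ (∂ᵢΔv)ⱼ = −∫ g'(|S|²) ∑ₖ∑ᵢⱼ (∂ₖSᵢⱼ)² − ½ ∫ g''(|S|²) ∑ₖ (∂ₖ|S|²)²`

(`(∂ᵢΔv)ⱼ = ∑ₖ∂ₖ∂ₖ(∂ᵢv)ⱼ`, no boundary terms on the torus, `∂ₖ(g'Sᵢⱼ) = g'∂ₖSᵢⱼ + g''∂ₖ|S|²Sᵢⱼ`,
`∑ᵢⱼ ∂ₖSᵢⱼ ∂ₖ(∂ᵢv)ⱼ = ∑ᵢⱼ(∂ₖSᵢⱼ)²`, `∑ᵢⱼ Sᵢⱼ ∂ₖ(∂ᵢv)ⱼ = ½∂ₖ|S|²`) — the analogue for the strain of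
Gibbon's Laplacian step (tree `integral_deriv_comp_mul_sum_mul_laplacian_torusVorticityTensor`).
For a convex nondecreasing weight both terms are nonpositive: this is the dissipation
`D₀ = q∫|S|^{q−2}(|∇S|² + (q−2)|∇|S||²)` of SIEVELD §3.3.

## Main statements

* `partialDeriv_laplacian_apply_eq_sum` — `(∂ᵢΔv)ⱼ = ∑ₖ ∂ₖ(y ↦ (∂ₖ∂ᵢv)(y)ⱼ)`.
* `integral_deriv_comp_strainSqAt_mul_sum_strain_laplacian` — the identity above.
-/

noncomputable section

open MeasureTheory Finset Set
open scoped InnerProductSpace RealInnerProductSpace ContDiff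

namespace Summit.NavierStokesRegularity.FunctionalMining

open Literature.Analysis.FunctionSpaces Literature.Analysis.FluidPDE

namespace GradientTensor

variable {d : Type*} [Fintype d] [DecidableEq d]

omit [DecidableEq d] in
/-- Smoothness of `g ∘ θ` for `g` smooth on a set containing the values of the smooth `θ`. [folklore] -/
private theorem isSmooth_comp' {g : ℝ → ℝ} {U : Set ℝ} (hg : ContDiffOn ℝ ∞ g U)
    {θ : UnitAddTorus d → ℝ} (hθ : Torus.IsSmooth θ) (hmaps : ∀ x, θ x ∈ U) :
    Torus.IsSmooth (fun y => g (θ y)) :=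
  hg.comp_contDiff hθ fun _ => hmaps _

/-- `(∂ᵢΔv)(x)ⱼ = ∑ₖ ∂ₖ(y ↦ (∂ₖ∂ᵢv)(y)ⱼ)(x)` for smooth `v` (`Δ = ∑ₖ∂ₖ∂ₖ`, `∂ᵢ∂ₖ∂ₖ = ∂ₖ∂ₖ∂ᵢ`).
[folklore] -/
theorem partialDeriv_laplacian_apply_eq_sum {v : UnitAddTorus d → EuclideanSpace ℝ d}
    (hv : Torus.IsSmooth v) (i j : d) (x : UnitAddTorus d) :
    Torus.partialDeriv i (Torus.laplacian v) x j =
      ∑ k, Torus.partialDeriv k (fun y => Torus.partialDeriv k (Torus.partialDeriv i v) y j) x := by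
  have hL : Torus.laplacian v = fun y => ∑ k, Torus.partialDeriv k (Torus.partialDeriv k v) y :=
    funext (Torus.laplacian_eq_sum_partialDeriv_partialDeriv hv)
  rw [hL, Torus.partialDeriv_finset_sum _
    (fun k _ => ((hv.partialDeriv k).partialDeriv k).isContDiff (by simp))]
  rw [WithLp.ofLp_sum, Finset.sum_apply]
  refine Finset.sum_congr rfl fun k _ => ?_
  have e1 : Torus.partialDeriv i (Torus.partialDeriv k (Torus.partialDeriv k v)) x =
      Torus.partialDeriv k (Torus.partialDeriv k (Torus.partialDeriv i v)) x := by
    rw [Torus.partialDeriv_comm (hv.partialDeriv k) i k x]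
    have : Torus.partialDeriv i (Torus.partialDeriv k v) = Torus.partialDeriv k (Torus.partialDeriv i v) :=
      funext fun y => Torus.partialDeriv_comm hv i k y
    rw [this]
  rw [e1, ← Torus.partialDeriv_apply_coord (((hv.partialDeriv i).partialDeriv k).isContDiff (by simp))]

omit [DecidableEq d] in
/-- For a symmetric `T`: `∑ᵢⱼ Tᵢⱼ Mᵢⱼ = ∑ᵢⱼ Tᵢⱼ (Mⱼᵢ + Mᵢⱼ)/2`. [folklore] -/
theorem sum_symm_mul_eq_sum_symm_mul_symmPart (T M : d → d → ℝ) (hT : ∀ i j, T i j = T j i) :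
    ∑ i, ∑ j, T i j * M i j = ∑ i, ∑ j, T i j * ((M j i + M i j) / 2) := by
  have hsym := sum_symm_mul_swap T M hT
  have e : ∑ i, ∑ j, T i j * ((M j i + M i j) / 2) =
      2⁻¹ * (∑ i, ∑ j, T i j * M j i) + 2⁻¹ * ∑ i, ∑ j, T i j * M i j := by
    rw [Finset.mul_sum, Finset.mul_sum, ← Finset.sum_add_distrib]
    refine Finset.sum_congr rfl fun i _ => ?_
    rw [Finset.mul_sum, Finset.mul_sum, ← Finset.sum_add_distrib]
    exact Finset.sum_congr rfl fun j _ => by ring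
  rw [e, hsym]
  ring

/-- **The viscous term of the weighted strain balance, by parts.** For smooth `v` on `T^d` and `g`
smooth on an open set containing the values of `|S|²`:
`∫ g'(|S|²)∑ᵢⱼSᵢⱼ(∂ᵢΔv)ⱼ = −∫ g'(|S|²)∑ₖ∑ᵢⱼ(∂ₖSᵢⱼ)² − ½∫ g''(|S|²)∑ₖ(∂ₖ|S|²)²`,
`Sᵢⱼ = ((∂ⱼv)ᵢ + (∂ᵢv)ⱼ)/2`, `∂ₖSᵢⱼ = ((∂ₖ∂ⱼv)ᵢ + (∂ₖ∂ᵢv)ⱼ)/2`. [ours] -/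
theorem integral_deriv_comp_strainSqAt_mul_sum_strain_laplacian
    {v : UnitAddTorus d → EuclideanSpace ℝ d} (hv : Torus.IsSmooth v)
    {g : ℝ → ℝ} {U : Set ℝ} (hU : IsOpen U) (hg : ContDiffOn ℝ ∞ g U)
    (hmaps : ∀ x, torusStrainSqAt v x ∈ U) :
    ∫ x, deriv g (torusStrainSqAt v x) * ∑ i, ∑ j,
        (Torus.partialDeriv j v x i + Torus.partialDeriv i v x j) / 2 *
          Torus.partialDeriv i (Torus.laplacian v) x j =
      -(∫ x, deriv g (torusStrainSqAt v x) * ∑ k, ∑ i, ∑ j,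
          ((Torus.partialDeriv k (Torus.partialDeriv j v) x i +
            Torus.partialDeriv k (Torus.partialDeriv i v) x j) / 2) ^ 2) -
        2⁻¹ * ∫ x, deriv (deriv g) (torusStrainSqAt v x) *
          ∑ k, Torus.partialDeriv k (torusStrainSqAt v) x ^ 2 := by
  -- smoothness bookkeeping
  have hQ : Torus.IsSmooth (torusStrainSqAt v) := isSmooth_strainSqAt hv
  have hg1 : ContDiffOn ℝ ∞ (deriv g) U := hg.deriv_of_isOpen hU le_rfl
  have hG1 : Torus.IsSmooth (fun y => deriv g (torusStrainSqAt v y)) := isSmooth_comp' hg1 hQ hmaps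
  have hG2 : Torus.IsSmooth (fun y => deriv (deriv g) (torusStrainSqAt v y)) :=
    isSmooth_comp' (hg1.deriv_of_isOpen hU le_rfl) hQ hmaps
  have hE : ∀ i j, Torus.IsSmooth
      (fun y => (Torus.partialDeriv j v y i + Torus.partialDeriv i v y j) / 2) :=
    fun i j => isSmooth_strainEntry hv i j
  have hb : ∀ i j k, Torus.IsSmooth (fun y => Torus.partialDeriv k (Torus.partialDeriv i v) y j) :=
    fun i j k => ((hv.partialDeriv i).partialDeriv k).apply j
  -- opaque names for the densities
  obtain ⟨G, hGdef⟩ : ∃ G : UnitAddTorus d → ℝ, G = fun y => deriv g (torusStrainSqAt v y) :=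
    ⟨_, rfl⟩
  obtain ⟨G2, hG2def⟩ : ∃ G : UnitAddTorus d → ℝ,
      G = fun y => deriv (deriv g) (torusStrainSqAt v y) := ⟨_, rfl⟩
  obtain ⟨E, hEdef⟩ : ∃ E : d → d → UnitAddTorus d → ℝ, E = fun i j y =>
      (Torus.partialDeriv j v y i + Torus.partialDeriv i v y j) / 2 := ⟨_, rfl⟩
  obtain ⟨B, hBdef⟩ : ∃ B : d → d → d → UnitAddTorus d → ℝ, B = fun k i j y =>
      Torus.partialDeriv k (Torus.partialDeriv i v) y j := ⟨_, rfl⟩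
  obtain ⟨DQ, hDQ⟩ : ∃ DQ : d → UnitAddTorus d → ℝ, DQ = fun k y =>
      Torus.partialDeriv k (torusStrainSqAt v) y := ⟨_, rfl⟩
  have hGs : Torus.IsSmooth G := by rw [hGdef]; exact hG1
  have hG2s : Torus.IsSmooth G2 := by rw [hG2def]; exact hG2
  have hEs : ∀ i j, Torus.IsSmooth (E i j) := by rw [hEdef]; exact hE
  have hBs : ∀ k i j, Torus.IsSmooth (B k i j) := by rw [hBdef]; exact fun k i j => hb i j k
  have hDQs : ∀ k, Torus.IsSmooth (DQ k) := by rw [hDQ]; exact fun k => hQ.partialDeriv k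
  -- calculus facts in the new names
  have hDG : ∀ k x, Torus.partialDeriv k G x = G2 x * DQ k x := by
    intro k x
    rw [hGdef, hG2def, hDQ]
    exact Torus.partialDeriv_comp_of_contDiffOn hg1 hU hQ hmaps k x
  have hDE : ∀ i j k x, Torus.partialDeriv k (E i j) x = (B k j i x + B k i j x) / 2 := by
    intro i j k x
    rw [hEdef, hBdef]
    exact partialDeriv_strainEntry hv i j k x
  have hLap : ∀ i j x, Torus.partialDeriv i (Torus.laplacian v) x j =
      ∑ k, Torus.partialDeriv k (B k i j) x := by
    intro i j x
    rw [hBdef]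
    exact partialDeriv_laplacian_apply_eq_sum hv i j x
  have hhalf : ∀ k x, ∑ i, ∑ j, E i j x * B k i j x = 2⁻¹ * DQ k x := by
    intro k x
    rw [hDQ, hEdef, hBdef]
    simp only
    rw [partialDeriv_strainSqAt hv k x]
    ring
  have hsq : ∀ k x, ∑ i, ∑ j, (B k j i x + B k i j x) / 2 * B k i j x =
      ∑ i, ∑ j, ((B k j i x + B k i j x) / 2) ^ 2 := by
    intro k x
    rw [sum_symm_mul_eq_sum_symm_mul_symmPart (fun i j => (B k j i x + B k i j x) / 2)
      (fun i j => B k i j x) (fun i j => by ring)]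
    exact Finset.sum_congr rfl fun i _ => Finset.sum_congr rfl fun j _ => by ring
  -- rewrite the statement in the new names
  have lhs_eq : (∫ x, deriv g (torusStrainSqAt v x) * ∑ i, ∑ j,
      (Torus.partialDeriv j v x i + Torus.partialDeriv i v x j) / 2 *
        Torus.partialDeriv i (Torus.laplacian v) x j) =
      ∫ x, G x * ∑ i, ∑ j, E i j x * ∑ k, Torus.partialDeriv k (B k i j) x := by
    rw [hGdef, hEdef]
    refine integral_congr_ae (ae_of_all _ fun x => ?_)
    simp only [hLap]
  have rhs1_eq : (∫ x, deriv g (torusStrainSqAt v x) * ∑ k, ∑ i, ∑ j,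
      ((Torus.partialDeriv k (Torus.partialDeriv j v) x i +
        Torus.partialDeriv k (Torus.partialDeriv i v) x j) / 2) ^ 2) =
      ∫ x, G x * ∑ k, ∑ i, ∑ j, ((B k j i x + B k i j x) / 2) ^ 2 := by
    rw [hGdef, hBdef]
  have rhs2_eq : (∫ x, deriv (deriv g) (torusStrainSqAt v x) *
      ∑ k, Torus.partialDeriv k (torusStrainSqAt v) x ^ 2) = ∫ x, G2 x * ∑ k, DQ k x ^ 2 := by
    rw [hG2def, hDQ]
  rw [lhs_eq, rhs1_eq, rhs2_eq]
  -- Step 1: by parts in each `(i, j, k)` term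
  have hint1 : ∀ i j k, Integrable (fun x => G x * E i j x * Torus.partialDeriv k (B k i j) x) :=
    fun i j k => ((hGs.continuous.mul (hEs i j).continuous).mul
      ((hBs k i j).partialDeriv k).continuous).integrable_unitAddTorus
  have hibp : ∀ i j k, ∫ x, G x * E i j x * Torus.partialDeriv k (B k i j) x =
      -∫ x, (G x * ((B k j i x + B k i j x) / 2) + G2 x * DQ k x * E i j x) * B k i j x := by
    intro i j k
    have hGE : Torus.IsSmooth (fun y => G y * E i j y) := hGs.mul (hEs i j)
    have h := Torus.integral_partialDeriv_mul_eq_neg_integral hGE (hBs k i j) k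
    have hprod : ∀ x, Torus.partialDeriv k (fun y => G y * E i j y) x =
        G x * ((B k j i x + B k i j x) / 2) + G2 x * DQ k x * E i j x := by
      intro x
      rw [Torus.partialDeriv_mul (hGs.isContDiff (by simp)) ((hEs i j).isContDiff (by simp)),
        hDG, hDE]
    simp_rw [hprod] at h
    linarith
  -- Step 2: the left side as `∑ₖ ∑ᵢ ∑ⱼ ∫ G Eᵢⱼ ∂ₖBₖᵢⱼ`
  have sum_comm3 : ∀ F : d → d → d → ℝ,
      ∑ i, ∑ j, ∑ k, F i j k = ∑ k, ∑ i, ∑ j, F i j k := fun F =>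
    (Finset.sum_congr rfl fun i _ => Finset.sum_comm).trans Finset.sum_comm
  have hL : ∫ x, G x * ∑ i, ∑ j, E i j x * ∑ k, Torus.partialDeriv k (B k i j) x =
      ∑ k, ∑ i, ∑ j, ∫ x, G x * E i j x * Torus.partialDeriv k (B k i j) x := by
    have e0 : ∀ x, G x * ∑ i, ∑ j, E i j x * ∑ k, Torus.partialDeriv k (B k i j) x =
        ∑ k, ∑ i, ∑ j, G x * E i j x * Torus.partialDeriv k (B k i j) x := by
      intro x
      rw [← sum_comm3]
      simp only [Finset.mul_sum]
      exact Finset.sum_congr rfl fun i _ => Finset.sum_congr rfl fun j _ =>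
        Finset.sum_congr rfl fun k _ => by ring
    simp_rw [e0]
    rw [integral_finsetSum _ (fun k _ => integrable_finsetSum _ fun i _ =>
      integrable_finsetSum _ fun j _ => hint1 i j k)]
    refine Finset.sum_congr rfl fun k _ => ?_
    rw [integral_finsetSum _ (fun i _ => integrable_finsetSum _ fun j _ => hint1 i j k)]
    exact Finset.sum_congr rfl fun i _ => integral_finsetSum _ fun j _ => hint1 i j k
  rw [hL]
  simp_rw [hibp]
  -- Step 3: for each `k`, recombine the `(i, j)` sum under the integral and contract
  have hint2 : ∀ i j k, Integrable
      (fun x => (G x * ((B k j i x + B k i j x) / 2) + G2 x * DQ k x * E i j x) * B k i j x) :=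
    fun i j k => (((hGs.continuous.mul (((hBs k j i).continuous.add (hBs k i j).continuous).div_const
      2)).add ((hG2s.continuous.mul (hDQs k).continuous).mul (hEs i j).continuous)).mul
        (hBs k i j).continuous).integrable_unitAddTorus
  have hk : ∀ k, ∑ i, ∑ j, -∫ x, (G x * ((B k j i x + B k i j x) / 2) +
      G2 x * DQ k x * E i j x) * B k i j x =
      -(∫ x, G x * ∑ i, ∑ j, ((B k j i x + B k i j x) / 2) ^ 2) -
        2⁻¹ * ∫ x, G2 x * DQ k x ^ 2 := by
    intro k
    -- collect the `(i, j)` sum under one integral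
    have e1 : ∑ i, ∑ j, -∫ x, (G x * ((B k j i x + B k i j x) / 2) +
        G2 x * DQ k x * E i j x) * B k i j x =
        -∫ x, ∑ i, ∑ j, (G x * ((B k j i x + B k i j x) / 2) +
          G2 x * DQ k x * E i j x) * B k i j x := by
      rw [integral_finsetSum _ (fun i _ => integrable_finsetSum _ fun j _ => hint2 i j k)]
      simp_rw [integral_finsetSum _ (fun j _ => hint2 _ j k)]
      simp only [Finset.sum_neg_distrib]
    -- pointwise contraction
    have e2 : ∀ x, ∑ i, ∑ j, (G x * ((B k j i x + B k i j x) / 2) +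
        G2 x * DQ k x * E i j x) * B k i j x =
        G x * ∑ i, ∑ j, ((B k j i x + B k i j x) / 2) ^ 2 + 2⁻¹ * (G2 x * DQ k x ^ 2) := by
      intro x
      rw [← hsq k x]
      have e3 : ∑ i, ∑ j, (G x * ((B k j i x + B k i j x) / 2) +
          G2 x * DQ k x * E i j x) * B k i j x =
          G x * ∑ i, ∑ j, (B k j i x + B k i j x) / 2 * B k i j x +
            G2 x * DQ k x * ∑ i, ∑ j, E i j x * B k i j x := by
        simp only [Finset.mul_sum, ← Finset.sum_add_distrib]
        exact Finset.sum_congr rfl fun i _ => Finset.sum_congr rfl fun j _ => by ring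
      rw [e3, hhalf k x]
      ring
    rw [e1]
    simp_rw [e2]
    have hiA : Integrable (fun x => G x * ∑ i, ∑ j, ((B k j i x + B k i j x) / 2) ^ 2) :=
      (hGs.continuous.mul (continuous_finsetSum _ fun i _ => continuous_finsetSum _
        fun j _ => (((hBs k j i).continuous.add (hBs k i j).continuous).div_const 2).pow
          2)).integrable_unitAddTorus
    have hiB : Integrable (fun x => 2⁻¹ * (G2 x * DQ k x ^ 2)) :=
      ((hG2s.continuous.mul ((hDQs k).continuous.pow 2)).const_mul _).integrable_unitAddTorus
    rw [integral_add hiA hiB, integral_const_mul]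
    ring
  simp_rw [hk]
  -- Step 4: sum over `k`
  have hfin : ∑ k, (-(∫ x, G x * ∑ i, ∑ j, ((B k j i x + B k i j x) / 2) ^ 2) -
      2⁻¹ * ∫ x, G2 x * DQ k x ^ 2) =
      -(∑ k, ∫ x, G x * ∑ i, ∑ j, ((B k j i x + B k i j x) / 2) ^ 2) -
        2⁻¹ * ∑ k, ∫ x, G2 x * DQ k x ^ 2 := by
    rw [Finset.sum_sub_distrib, Finset.sum_neg_distrib, Finset.mul_sum]
  rw [hfin]
  have eA : ∑ k, ∫ x, G x * ∑ i, ∑ j, ((B k j i x + B k i j x) / 2) ^ 2 =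
      ∫ x, G x * ∑ k, ∑ i, ∑ j, ((B k j i x + B k i j x) / 2) ^ 2 := by
    have hBc : ∀ k i j, Continuous (B k i j) := fun k i j => (hBs k i j).continuous
    have hGc : Continuous G := hGs.continuous
    have hc : ∀ k, Continuous (fun x => G x * ∑ i, ∑ j, ((B k j i x + B k i j x) / 2) ^ 2) :=
      fun k => by fun_prop
    rw [← integral_finsetSum Finset.univ
      (f := fun k x => G x * ∑ i, ∑ j, ((B k j i x + B k i j x) / 2) ^ 2)
      (fun k _ => (hc k).integrable_unitAddTorus)]
    exact integral_congr_ae (ae_of_all _ fun x => (Finset.mul_sum _ _ _).symm)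
  have eB : ∑ k, ∫ x, G2 x * DQ k x ^ 2 = ∫ x, G2 x * ∑ k, DQ k x ^ 2 := by
    have hDQc : ∀ k, Continuous (DQ k) := fun k => (hDQs k).continuous
    have hG2c : Continuous G2 := hG2s.continuous
    have hc : ∀ k, Continuous (fun x => G2 x * DQ k x ^ 2) := fun k => by fun_prop
    rw [← integral_finsetSum Finset.univ (f := fun k x => G2 x * DQ k x ^ 2)
      (fun k _ => (hc k).integrable_unitAddTorus)]
    exact integral_congr_ae (ae_of_all _ fun x => (Finset.mul_sum _ _ _).symm)
  rw [eA, eB]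

end GradientTensor

end Summit.NavierStokesRegularity.FunctionalMining
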